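import Summits.Ventures.PercRepro.SixFourT4Bridge

/-!
# PercRepro — C-025 at `(6,4)`, §22.2 as an inequality: `lpp ≥ Σ_ℓ ε(m_ℓ)·π₂(ℓ)` (p3, gen 8)

mine-2's `MINE2-RLS.md` §22.2 states `lpp = Σ_ℓ ε(m_ℓ)·π₂(ℓ)`, `π₂(ℓ)` = the pairs of points of `G ∖ ℓ` that are not
coplanar with `ℓ` (in different classes of `ℓ`, the classes being the traces `(P ∩ G) ∖ ℓ` of the planes `P ⊇ ℓ`).
For the §22.5 assembly a LOWER bound on `lpp` suffices (it enters `J₄` with the coefficient `+2/3`), and that is what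
is proved here: the triples `(ℓ, L′, {x, a})` — `L′ ⊆ ℓ ∩ G` with `|L′| ≥ 3`, `{x, a}` a cross-class pair of `ℓ` — map
injectively to the rank-`4` sets `B′ = L′ ∪ {x, a}` whose coloops are exactly `x` and `a` (`m(B′) = 2`):
`coloopsOf_lppSet`, `lpp_ge` (the count of the triples is `Σ_ℓ ε(m_ℓ)·π₂(ℓ)`, `card_crossPairs`:
`π₂(ℓ) = C(g − m_ℓ, 2) − Σ_{P ⊇ ℓ} C(|P ∩ G| − m_ℓ, 2)`).
-/

namespace PercRepro.SixFour

open Finset ThmH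

variable {α : Type*} [DecidableEq α] {M : Matroid α} [M.Finite] {G : Finset α}

/-! ## Classes of a line and cross-class pairs -/

/-- The cross-class pairs of `ℓ`: `2`-subsets `{x, a}` of `G ∖ ℓ` with `a ∉ cl(ℓ ∪ x)`. -/
noncomputable def crossPairs (M : Matroid α) [M.Finite] (G L : Finset α) : Finset (Finset α) :=
  ((G \ L).powersetCard 2).filter (fun q : Finset α => ∀ x ∈ q, ∀ a ∈ q, x ≠ a → a ∉ clF M (insert x L))

omit [DecidableEq α] in
/-- The subsets with at least `3` elements of an `m`-set number `ε(m)`. -/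
theorem card_powerset_filter_three_le (T : Finset α) :
    (T.powerset.filter (fun Z : Finset α => 3 ≤ Z.card)).card = eps T.card := by
  have h := Finset.card_filter_add_card_filter_not (s := T.powerset) (fun Z : Finset α => Z.card ≤ 2)
  have hle : (T.powerset.filter (fun Z : Finset α => Z.card ≤ 2)).card = 1 + T.card + T.card.choose 2 := by
    rw [Finset.powerset_card_disjiUnion, Finset.filter_disjiUnion, Finset.card_disjiUnion]
    have hterm : ∀ i ∈ Finset.range (T.card + 1),
        ((T.powersetCard i).filter (fun Z : Finset α => Z.card ≤ 2)).card = if i ≤ 2 then T.card.choose i else 0 := by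
      intro i _
      split_ifs with hi
      · rw [Finset.filter_true_of_mem, Finset.card_powersetCard]
        intro Z hZ
        rw [(Finset.mem_powersetCard.1 hZ).2]
        exact hi
      · rw [Finset.card_eq_zero, Finset.filter_false_of_mem]
        intro Z hZ
        rw [(Finset.mem_powersetCard.1 hZ).2]
        exact hi
    rw [Finset.sum_congr rfl hterm, ← Finset.sum_filter]
    have hsub : (Finset.range (T.card + 1)).filter (fun i => i ≤ 2) ⊆ Finset.range 3 := by
      intro i hi
      rw [Finset.mem_filter] at hi
      rw [Finset.mem_range]
      omega
    rw [Finset.sum_subset hsub (fun i hi hni => ?_)]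
    · simp only [Finset.sum_range_succ, Finset.sum_range_zero, Nat.choose_zero_right, Nat.choose_one_right]
    · rw [Finset.mem_range] at hi
      rw [Finset.mem_filter, Finset.mem_range, not_and] at hni
      have : T.card < i := by
        by_contra h
        exact hni (by omega) (by omega)
      exact Nat.choose_eq_zero_of_lt this
  have hcongr : T.powerset.filter (fun Z : Finset α => ¬ Z.card ≤ 2) =
      T.powerset.filter (fun Z : Finset α => 3 ≤ Z.card) :=
    Finset.filter_congr (fun Z _ => by omega)
  rw [hle, hcongr, Finset.card_powerset] at h
  unfold eps
  omega

/-! ## The lpp sets `L′ ∪ {x, a}` -/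

omit [DecidableEq α] in
/-- The closure of a subset `L′ ⊆ ℓ ∩ G` with at least two points is the line `ℓ`. -/
theorem clF_eq_of_subset_line (hs : Simple M) {L L' : Finset α} (hL : L ∈ lines M) (hL' : L' ⊆ L)
    (h2 : 2 ≤ L'.card) : clF M L' = L := by
  apply Finset.coe_injective
  rw [coe_clF]
  exact closure_eq_of_subset_line hL hL' (eRk_eq_two_of_subset_line hs hL hL' h2)

/-- For `L′ ⊆ ℓ` with `|L′| ≥ 3`, `x ∈ G ∖ ℓ` and `a ∉ cl(ℓ ∪ x)` (`a ∈ G`): the set `B′ = L′ ∪ {x, a}` has rank `4`,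
and its coloops are exactly `x` and `a`. -/
theorem coloopsOf_lppSet (hs : Simple M) (hG : G ⊆ gr M) {L L' : Finset α} (hL : L ∈ lines M)
    (hL' : L' ⊆ L ∩ G) (h3 : 3 ≤ L'.card) {x a : α} (hx : x ∈ G) (hxL : x ∉ L) (ha : a ∈ G)
    (haL : a ∉ L) (hxa : a ∉ clF M (insert x L)) :
    M.eRk ((insert a (insert x L') : Finset α) : Set α) = 4 ∧ coloopsOf M (insert a (insert x L')) = {x, a} := by
  have hL'L : L' ⊆ L := hL'.trans Finset.inter_subset_left
  have hL'G : L' ⊆ G := hL'.trans Finset.inter_subset_right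
  have hcl' : clF M L' = L := clF_eq_of_subset_line hs hL hL'L (by omega)
  have hr3 : M.eRk ((insert x L' : Finset α) : Set α) = 3 := eRk_insert_eq_three hs hL hL'L (by omega) (hG hx) hxL
  have hxL' : x ∉ L' := fun h => hxL (hL'L h)
  have hax : a ≠ x := fun h => hxa (by
    rw [h, mem_clF]
    exact M.mem_closure_of_mem' (Finset.mem_coe.2 (Finset.mem_insert_self x L))
      (by rw [← coe_gr M]; exact Finset.mem_coe.2 (hG hx)))
  -- `a ∉ cl(insert x L′)` since `cl(insert x L′) ⊆ cl(insert x L)`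
  have hacl' : a ∉ M.closure ((insert x L' : Finset α) : Set α) := by
    intro h
    apply hxa
    rw [mem_clF]
    exact M.closure_subset_closure (Finset.coe_subset.2 (Finset.insert_subset_insert x hL'L)) h
  have haxL' : a ∉ insert x L' := fun h => by
    rcases Finset.mem_insert.1 h with h | h
    · exact hax h
    · exact haL (hL'L h)
  have hr4 : M.eRk ((insert a (insert x L') : Finset α) : Set α) = 4 := by
    have hE : a ∈ M.E \ M.closure ((insert x L' : Finset α) : Set α) :=
      ⟨by rw [← coe_gr M]; exact Finset.mem_coe.2 (hG ha), hacl'⟩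
    rw [Finset.coe_insert, Matroid.eRk_insert_eq_add_one hE, hr3]
    rfl
  refine ⟨hr4, ?_⟩
  ext y
  rw [mem_coloopsOf]
  simp only [Finset.mem_insert, Finset.mem_singleton]
  constructor
  · rintro ⟨hy, hycl⟩
    by_contra hne
    push Not at hne
    -- `y ∈ L′`: removing `y` leaves `≥ 2` points of `L′`, whose closure `ℓ` contains `y`
    have hyL' : y ∈ L' := by
      rcases hy with h | h | h
      · exact absurd h hne.2
      · exact absurd h hne.1
      · exact h
    apply hycl
    have hsub : L'.erase y ⊆ (insert a (insert x L')).erase y := by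
      intro z hz
      rw [Finset.mem_erase] at hz ⊢
      exact ⟨hz.1, Finset.mem_insert_of_mem (Finset.mem_insert_of_mem hz.2)⟩
    have hcl2 : clF M (L'.erase y) = L :=
      clF_eq_of_subset_line hs hL ((Finset.erase_subset y L').trans hL'L) (by rw [Finset.card_erase_of_mem hyL']; omega)
    have hyL : y ∈ L := hL'L hyL'
    have : y ∈ clF M (L'.erase y) := by rw [hcl2]; exact hyL
    rw [mem_clF] at this
    exact M.closure_subset_closure (Finset.coe_subset.2 hsub) this
  · rintro (rfl | rfl)
    · -- `x` is a coloop: `B′ ∖ x = insert a L′` has rank `3`, `x ∉ cl`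
      refine ⟨Or.inr (Or.inl rfl), ?_⟩
      have he : (insert a (insert y L')).erase y = insert a L' := by
        rw [Finset.erase_insert_of_ne hax, Finset.erase_insert hxL']
      rw [he]
      -- `cl(insert a L′) = cl(insert a ℓ)`, and `y = x ∉ cl(insert a ℓ)` because `a ∉ cl(insert x ℓ)` (symmetry)
      intro hycl
      apply hxa
      rw [mem_clF]
      have hyE : y ∈ M.E := by rw [← coe_gr M]; exact Finset.mem_coe.2 (hG hx)
      have haE : a ∈ M.E := by rw [← coe_gr M]; exact Finset.mem_coe.2 (hG ha)
      -- exchange: `y ∈ cl(L′ ∪ a) ∖ cl(L′)` ⇒ `a ∈ cl(L′ ∪ y)`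
      have hyncl : y ∉ M.closure (L' : Set α) := by
        intro h
        apply hxL
        have := (clF_mem_lines (hL'G.trans hG) (eRk_eq_two_of_subset_line hs hL hL'L (by omega))).1
        rw [← hcl', mem_clF]
        exact h
      have hex := Matroid.mem_closure_insert hyncl (by rwa [Finset.coe_insert] at hycl)
      exact M.closure_subset_closure (by
        rw [Finset.coe_insert]
        exact Set.insert_subset_insert (Finset.coe_subset.2 hL'L)) hex
    · -- `a` is a coloop: `B′ ∖ a = insert x L′`, `a ∉ cl`
      refine ⟨Or.inl rfl, ?_⟩
      rw [Finset.erase_insert haxL']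
      exact hacl'

/-! ## The injection `(ℓ, L′, {x, a}) ↦ L′ ∪ {x, a}` and the lower bound on `lpp` -/

/-- The triples `(ℓ, L′, q)`: a line `ℓ`, a subset `L′ ⊆ ℓ ∩ G` with `≥ 3` points, a cross-class pair `q` of `ℓ`. -/
noncomputable def lppTriples (M : Matroid α) [M.Finite] (G : Finset α) :
    Finset (Σ _ : Finset α, Σ _ : Finset α, Finset α) :=
  (lines M).sigma (fun L => ((L ∩ G).powerset.filter (fun L' : Finset α => 3 ≤ L'.card)).sigma
    (fun _ => crossPairs M G L))

/-- The number of triples is `Σ_ℓ ε(m_ℓ)·#crossPairs(ℓ)`. -/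
theorem card_lppTriples :
    (lppTriples M G).card = ∑ L ∈ lines M, eps (L ∩ G).card * (crossPairs M G L).card := by
  unfold lppTriples
  rw [Finset.card_sigma]
  refine Finset.sum_congr rfl (fun L _ => ?_)
  rw [Finset.card_sigma, Finset.sum_const, smul_eq_mul, card_powerset_filter_three_le]

/-- A cross-class pair is `{x, a}` with `x ≠ a` in `G ∖ ℓ`, `a ∉ cl(ℓ ∪ x)` and `x ∉ cl(ℓ ∪ a)`. -/
theorem crossPairs_eq {L q : Finset α} (hq : q ∈ crossPairs M G L) :
    ∃ x a, q = {x, a} ∧ x ≠ a ∧ x ∈ G ∧ x ∉ L ∧ a ∈ G ∧ a ∉ L ∧ a ∉ clF M (insert x L) := by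
  unfold crossPairs at hq
  rw [Finset.mem_filter, Finset.mem_powersetCard] at hq
  obtain ⟨⟨hqG, hc⟩, hcross⟩ := hq
  obtain ⟨x, a, hxa, rfl⟩ := Finset.card_eq_two.1 hc
  have hx := Finset.mem_sdiff.1 (hqG (Finset.mem_insert_self x {a}))
  have ha := Finset.mem_sdiff.1 (hqG (Finset.mem_insert_of_mem (Finset.mem_singleton_self a)))
  exact ⟨x, a, rfl, hxa, hx.1, hx.2, ha.1, ha.2,
    hcross x (Finset.mem_insert_self x {a}) a (Finset.mem_insert_of_mem (Finset.mem_singleton_self a)) hxa⟩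

/-- `L′ ∪ {x, a} = insert a (insert x L′)`. -/
theorem union_pair_eq (L' : Finset α) (x a : α) : L' ∪ {x, a} = insert a (insert x L') := by
  ext y
  simp only [Finset.mem_union, Finset.mem_insert, Finset.mem_singleton]
  tauto

/-- The image of a triple is a rank-`4` subset of `G` with exactly two coloops. -/
theorem lppTriple_image_mem (hs : Simple M) (hG : G ⊆ gr M) {t : Σ _ : Finset α, Σ _ : Finset α, Finset α}
    (ht : t ∈ lppTriples M G) : t.2.1 ∪ t.2.2 ∈ (R4 M G).filter (fun B : Finset α => mTr M B = 2) := by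
  obtain ⟨L, L', q⟩ := t
  unfold lppTriples at ht
  simp only [Finset.mem_sigma, Finset.mem_filter, Finset.mem_powerset] at ht
  obtain ⟨hL, ⟨hL'sub, h3⟩, hq⟩ := ht
  obtain ⟨x, a, rfl, hxa, hx, hxL, ha, haL, hcl⟩ := crossPairs_eq hq
  obtain ⟨hr4, hcol⟩ := coloopsOf_lppSet hs hG hL hL'sub h3 hx hxL ha haL hcl
  show L' ∪ {x, a} ∈ _
  rw [union_pair_eq, Finset.mem_filter, mem_R4]
  refine ⟨⟨?_, hr4⟩, ?_⟩
  · intro y hy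
    rcases Finset.mem_insert.1 hy with rfl | hy
    · exact ha
    · rcases Finset.mem_insert.1 hy with rfl | hy
      · exact hx
      · exact (hL'sub.trans Finset.inter_subset_right) hy
  · unfold mTr
    rw [hcol, Finset.card_pair hxa]

/-- The map `(ℓ, L′, q) ↦ L′ ∪ q` is injective on the triples: `q` is recovered as the coloop set, `L′` as the rest,
`ℓ` as the closure of `L′`. -/
theorem lppTriple_injOn (hs : Simple M) (hG : G ⊆ gr M) :
    Set.InjOn (fun t : Σ _ : Finset α, Σ _ : Finset α, Finset α => t.2.1 ∪ t.2.2) (lppTriples M G : Set _) := by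
  rintro ⟨L₁, L₁', q₁⟩ ht₁ ⟨L₂, L₂', q₂⟩ ht₂ heq
  rw [Finset.mem_coe] at ht₁ ht₂
  have key : ∀ (L L' q : Finset α), (⟨L, L', q⟩ : Σ _ : Finset α, Σ _ : Finset α, Finset α) ∈ lppTriples M G →
      coloopsOf M (L' ∪ q) = q ∧ (L' ∪ q) \ q = L' ∧ clF M L' = L := by
    intro L L' q ht
    unfold lppTriples at ht
    simp only [Finset.mem_sigma, Finset.mem_filter, Finset.mem_powerset] at ht
    obtain ⟨hL, ⟨hL'sub, h3⟩, hq⟩ := ht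
    obtain ⟨x, a, rfl, hxa, hx, hxL, ha, haL, hcl⟩ := crossPairs_eq hq
    obtain ⟨-, hcol⟩ := coloopsOf_lppSet hs hG hL hL'sub h3 hx hxL ha haL hcl
    refine ⟨by rw [union_pair_eq, hcol], ?_, clF_eq_of_subset_line hs hL (hL'sub.trans Finset.inter_subset_left) (by omega)⟩
    rw [Finset.union_sdiff_right, Finset.sdiff_eq_self_of_disjoint]
    rw [Finset.disjoint_left]
    intro y hy hyq
    rcases Finset.mem_insert.1 hyq with rfl | hyq
    · exact hxL ((hL'sub.trans Finset.inter_subset_left) hy)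
    · rw [Finset.mem_singleton] at hyq
      subst hyq
      exact haL ((hL'sub.trans Finset.inter_subset_left) hy)
  obtain ⟨c₁, r₁, l₁⟩ := key L₁ L₁' q₁ ht₁
  obtain ⟨c₂, r₂, l₂⟩ := key L₂ L₂' q₂ ht₂
  have heq' : L₁' ∪ q₁ = L₂' ∪ q₂ := heq
  have hq : q₁ = q₂ := by rw [← c₁, ← c₂, heq']
  have hL' : L₁' = L₂' := by rw [← r₁, ← r₂, heq', hq]
  have hL : L₁ = L₂ := by rw [← l₁, ← l₂, hL']
  subst hq hL' hL
  rfl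

/-- **`lpp ≥ Σ_ℓ ε(m_ℓ)·#crossPairs(ℓ)`** (§22.2 as an inequality). -/
theorem lpp_ge (hs : Simple M) (hG : G ⊆ gr M) :
    ∑ L ∈ lines M, eps (L ∩ G).card * (crossPairs M G L).card ≤ lpp M G := by
  rw [← card_lppTriples]
  unfold lpp
  exact Finset.card_le_card_of_injOn _ (fun t ht => lppTriple_image_mem hs hG (Finset.mem_coe.1 ht))
    (lppTriple_injOn hs hG)

/-! ## `#crossPairs(ℓ) = C(g − m_ℓ, 2) − Σ_{P ⊇ ℓ} C(|P ∩ G| − m_ℓ, 2)` -/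

/-- The same-class pairs of `ℓ`: the pairs inside one class `(P ∩ G) ∖ ℓ`, `P` a plane through `ℓ`. -/
noncomputable def samePairs (M : Matroid α) [M.Finite] (G L : Finset α) : Finset (Finset α) :=
  ((planes M).filter (fun P : Finset α => L ⊆ P)).biUnion (fun P => ((P ∩ G) \ L).powersetCard 2)

/-- Two distinct planes through `ℓ` share no point off `ℓ`. -/
theorem planes_through_line_disjoint (hs : Simple M) (hG : G ⊆ gr M) {L P P' : Finset α} (hL : L ∈ lines M)
    (hP : P ∈ planes M) (hP' : P' ∈ planes M) (hLP : L ⊆ P) (hLP' : L ⊆ P') (hne : P ≠ P') :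
    Disjoint (((P ∩ G) \ L).powersetCard 2) (((P' ∩ G) \ L).powersetCard 2) := by
  rw [Finset.disjoint_left]
  intro q hq hq'
  rw [Finset.mem_powersetCard] at hq hq'
  obtain ⟨x, hxq⟩ := Finset.card_pos.1 (by omega : 0 < q.card)
  have hx := Finset.mem_sdiff.1 (hq.1 hxq)
  have hx' := Finset.mem_sdiff.1 (hq'.1 hxq)
  have h2 : 2 ≤ L.card := by
    have := (mem_lines.1 hL).2.2
    have hle := M.eRk_le_encard (L : Set α)
    rw [this, Set.encard_coe_eq_coe_finsetCard] at hle
    exact_mod_cast hle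
  have hr3 := eRk_insert_eq_three hs hL (Finset.Subset.refl L) h2 (hG (Finset.mem_inter.1 hx.1).2) hx.2
  have hsub : insert x L ⊆ P := Finset.insert_subset (Finset.mem_inter.1 hx.1).1 hLP
  have hsub' : insert x L ⊆ P' := Finset.insert_subset (Finset.mem_inter.1 hx'.1).1 hLP'
  exact hne (planes_eq_of_subset hP hP' hsub hsub' hr3)

/-- `#samePairs(ℓ) = Σ_{P ⊇ ℓ} C(|P ∩ G| − m_ℓ, 2)`, `m_ℓ = |ℓ ∩ G|`. -/
theorem card_samePairs (hs : Simple M) (hG : G ⊆ gr M) {L : Finset α} (hL : L ∈ lines M) :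
    (samePairs M G L).card =
      ∑ P ∈ (planes M).filter (fun P : Finset α => L ⊆ P), ((P ∩ G).card - (L ∩ G).card).choose 2 := by
  unfold samePairs
  rw [Finset.card_biUnion (fun P hP P' hP' hne => planes_through_line_disjoint hs hG hL
    (Finset.mem_filter.1 hP).1 (Finset.mem_filter.1 hP').1 (Finset.mem_filter.1 hP).2 (Finset.mem_filter.1 hP').2 hne)]
  refine Finset.sum_congr rfl (fun P hP => ?_)
  rw [Finset.card_powersetCard, Finset.card_sdiff]
  have hLP := (Finset.mem_filter.1 hP).2
  have : L ∩ (P ∩ G) = L ∩ G := by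
    ext y
    simp only [Finset.mem_inter]
    exact ⟨fun h => ⟨h.1, h.2.2⟩, fun h => ⟨h.1, hLP h.1, h.2⟩⟩
  rw [this]

/-- The same-class pairs are pairs of `G ∖ ℓ`. -/
theorem samePairs_subset (L : Finset α) : samePairs M G L ⊆ (G \ L).powersetCard 2 := by
  intro q hq
  unfold samePairs at hq
  obtain ⟨P, -, hq⟩ := Finset.mem_biUnion.1 hq
  rw [Finset.mem_powersetCard] at hq ⊢
  refine ⟨hq.1.trans ?_, hq.2⟩
  intro y hy
  rw [Finset.mem_sdiff] at hy ⊢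
  exact ⟨(Finset.mem_inter.1 hy.1).2, hy.2⟩

/-- The cross-class pairs are the pairs of `G ∖ ℓ` that are not same-class pairs. -/
theorem crossPairs_eq_sdiff (hs : Simple M) (hG : G ⊆ gr M) {L : Finset α} (hL : L ∈ lines M) :
    crossPairs M G L = (G \ L).powersetCard 2 \ samePairs M G L := by
  have h2 : 2 ≤ L.card := by
    have := (mem_lines.1 hL).2.2
    have hle := M.eRk_le_encard (L : Set α)
    rw [this, Set.encard_coe_eq_coe_finsetCard] at hle
    exact_mod_cast hle
  ext q
  unfold crossPairs samePairs
  rw [Finset.mem_filter, Finset.mem_sdiff, Finset.mem_biUnion]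
  constructor
  · rintro ⟨hq, hcross⟩
    refine ⟨hq, ?_⟩
    rintro ⟨P, hP, hqP⟩
    rw [Finset.mem_filter] at hP
    rw [Finset.mem_powersetCard] at hqP hq
    obtain ⟨x, a, hxa, rfl⟩ := Finset.card_eq_two.1 hq.2
    have hx := Finset.mem_sdiff.1 (hqP.1 (Finset.mem_insert_self x {a}))
    have ha := Finset.mem_sdiff.1 (hqP.1 (Finset.mem_insert_of_mem (Finset.mem_singleton_self a)))
    apply hcross x (Finset.mem_insert_self x {a}) a (Finset.mem_insert_of_mem (Finset.mem_singleton_self a)) hxa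
    -- `cl(insert x ℓ) = P` (rank `3` inside the plane `P`)
    have hr3 := eRk_insert_eq_three hs hL (Finset.Subset.refl L) h2 (hG (Finset.mem_inter.1 hx.1).2) hx.2
    have hsub : insert x L ⊆ P := Finset.insert_subset (Finset.mem_inter.1 hx.1).1 hP.2
    have hcl : clF M (insert x L) = P := by
      apply Finset.coe_injective
      rw [coe_clF]
      exact closure_eq_of_subset_plane hP.1 hsub hr3
    rw [hcl]
    exact (Finset.mem_inter.1 ha.1).1
  · rintro ⟨hq, hnone⟩
    refine ⟨hq, ?_⟩
    intro x hx a ha hxa hcl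
    apply hnone
    rw [Finset.mem_powersetCard] at hq
    have hxG := Finset.mem_sdiff.1 (hq.1 hx)
    have haG := Finset.mem_sdiff.1 (hq.1 ha)
    have hr3 := eRk_insert_eq_three hs hL (Finset.Subset.refl L) h2 (hG hxG.1) hxG.2
    obtain ⟨hP, hsub⟩ := clF_mem_planes (Finset.insert_subset (hG hxG.1) (mem_lines.1 hL).1) hr3
    refine ⟨clF M (insert x L), Finset.mem_filter.2 ⟨hP, (Finset.subset_insert x L).trans hsub⟩, ?_⟩
    rw [Finset.mem_powersetCard]
    refine ⟨?_, hq.2⟩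
    -- `q = {x, a}` (two elements, both in `cl(insert x ℓ) ∩ G ∖ ℓ`)
    obtain ⟨x', a', hxa', hq2⟩ := Finset.card_eq_two.1 hq.2
    have hmem : ∀ y ∈ q, y ∈ (clF M (insert x L) ∩ G) \ L := by
      intro y hy
      rw [Finset.mem_sdiff, Finset.mem_inter]
      have hyG := Finset.mem_sdiff.1 (hq.1 hy)
      refine ⟨⟨?_, hyG.1⟩, hyG.2⟩
      -- `y = x` or `y = a` (a 2-set containing the distinct `x`, `a`)
      have hxy : y = x ∨ y = a := by
        rw [hq2] at hx ha hy
        simp only [Finset.mem_insert, Finset.mem_singleton] at hx ha hy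
        rcases hx with rfl | rfl <;> rcases ha with rfl | rfl <;> rcases hy with rfl | rfl <;> simp_all
      rcases hxy with rfl | rfl
      · exact hsub (Finset.mem_insert_self y L)
      · exact hcl
    exact hmem

/-- **`#crossPairs(ℓ) = C(g − m_ℓ, 2) − Σ_{P ⊇ ℓ} C(|P ∩ G| − m_ℓ, 2)`** (§22.2, `π₂(ℓ)`). -/
theorem card_crossPairs (hs : Simple M) (hG : G ⊆ gr M) {L : Finset α} (hL : L ∈ lines M) :
    (crossPairs M G L).card = (G.card - (L ∩ G).card).choose 2 -
      ∑ P ∈ (planes M).filter (fun P : Finset α => L ⊆ P), ((P ∩ G).card - (L ∩ G).card).choose 2 := by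
  rw [crossPairs_eq_sdiff hs hG hL, Finset.card_sdiff_of_subset (samePairs_subset L), Finset.card_powersetCard,
    Finset.card_sdiff, card_samePairs hs hG hL]

end PercRepro.SixFour
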